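import Summits.PneNP.PneNP.Theses.OneSlice
import Summits.PneNP.PneNP.Theorems.ConstantBand.Negative.LoadBearing
import Literature.Computability.Complexity.RossmanMonotoneCliqueGraphs

/-!
# `forcing-contrast-hole-cap` for crux `ConstantBand` (stmt-PneNP-2834) — TYPED RECORD of a line that DIED AT PLANNING

Planner seat `cruxplan-stmt-PneNP-2834-forcing-contrast-hol` (crux-plan, round 1), 2026-08-16. This file is NOT a
line skeleton (there is deliberately no `Lines/forcing-contrast-hole-cap.lean`): it is the sorry-free typed record of
what the skeleton would have been — the vocabulary of idea card `Ideas/forcing-contrast-hole-cap.md`, its four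
statements as `Prop`s (`TopWitnesses` = (R), `CFDescent` = (HC), `HoleCap` = (H), `Census` = (J)), the
kernel-checked composition `constantBand_of_hyps : TopWitnesses → CFDescent → HoleCap → Census → ConstantBand`
— together with the reason the line is dead: **`HoleCap` (the card's conjecture (H), in every reading the card and the
triage gave it) is FALSE**, refuted by the explicit two-gate monotone gadget `gadget` below
(`[u₀v₀ ∈ x] ∧ [|x ∩ E(U)| ≥ a]`: a rare pendant CORE edge buys contrast, a fluctuating COUNT at its γ-quantile buys
forcing and holes), and the supply-form / anchor-free / tameness repairs either stay false with a `k`-independent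
exponent or collapse into the crux itself. Details, exponents and the junk-program construction that makes (HC)
vacuous: `Lines/forcing-contrast-hole-cap.md` (this dead-line report) and `NegativeNote-forgeable-witnesses.md` in this crux directory.

For the standing disprover (cdisprove): typed targets are `¬ HoleCap` and `¬ HoleCapSupply` (instantiate
`φ := gadget n e₀ U a` with `U` = the first `⌊n/2⌋` vertices, `u₀ ∈ U`, `v₀ ∉ U`, `a − (e_F − 1)` = the
`γ/2`-quantile of `|x ∩ E(U)|` on the slice; the only analytic input is the hypergeometric local limit
`P_i[|x ∩ E(U)| = m] ≥ c/σ` at `m` within `O(σ)` of the mean). For the merged closure line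
(`critical-closure-pivotal-descent`): `TopWitnesses` (true, provable now) and the `Census` arithmetic survive verbatim;
what does not survive is ANY witness filter that reads only the gate function's band statistics on bounded patterns
plus its values at `x ∪ (bounded patterns)`.

Vocabulary is over tree declarations only (`slice`, `Central`, `BandLB`, `constantBand_iff` of the landed
`Theorems/ConstantBand/Negative/LoadBearing.lean`; `edgeCount`, `cliqueFn`, `cliqueVec`, `supp`, `medJ`, `onSet` of
`Literature.Computability.Complexity`). No `sorry`, no axioms.
-/

set_option linter.dupNamespace false

noncomputable section

open Finset hiding slice
open Filter
open scoped Classical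

namespace Summit.PneNP.PneNP.Cruxes.ConstantBand.ForcingContrastHoleCap

open Literature.Computability.Complexity
open Summit.PneNP.PneNP.Theorems.ConstantBand.Negative (Edge slice Central BandLB bandErr constantBand_iff)

variable {n : ℕ}

/-! ## Vocabulary of the line (plain definitions over tree declarations; no axioms, no sorry) -/

/-- Band error of a Boolean FUNCTION `f` against `CLIQUE_k` on the band `[j-w, j+w]` (centre-uniform:
each slice normalised by its own size). For a circuit, `bandErr n k j w C = bandErrFn n k j w C.eval`
by `rfl`. [folklore] -/
def bandErrFn (n k j w : ℕ) (f : (Edge n → Bool) → Bool) : ℝ :=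
  ∑ i ∈ Icc (j - w) (j + w),
    (#(univ.filter fun x : Edge n → Bool => edgeCount x = i ∧ f x ≠ cliqueFn n k x) : ℝ) / (#(slice n i) : ℝ)

/-- Conditional REJECTION fraction of `φ` on the slice `i` given the pattern `P`:
`#{x : e(x) = i, P ⊆ x, φ x = 0} / #{x : e(x) = i, P ⊆ x}` (`0` on an empty condition). [folklore] -/
def condRej (n i : ℕ) (φ : (Edge n → Bool) → Bool) (P : Edge n → Bool) : ℝ :=
  (#((slice n i).filter fun x => P ≤ x ∧ φ x = false) : ℝ) / (#((slice n i).filter fun x => P ≤ x) : ℝ)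

/-- Conditional ACCEPTANCE fraction of `φ` on the slice `i` given the pattern `D`. [folklore] -/
def condAcc (n i : ℕ) (φ : (Edge n → Bool) → Bool) (D : Edge n → Bool) : ℝ :=
  (#((slice n i).filter fun x => D ≤ x ∧ φ x = true) : ℝ) / (#((slice n i).filter fun x => D ≤ x) : ℝ)

/-- **γ-forcing** (card (C), conditional = slice-native form): the pattern `P` is `γ`-forcing for `φ`
w.r.t. the band `[j-w, j+w]` if, summed over the `2w+1` slices, the conditional rejection of `φ` given
`x ⊇ P` is at most `γ·(2w+1)` — Rossman's ⋆-closure condition "E[f(G⁻ ∪ H)] ≥ 1 − λ" with "∪ H"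
replaced by "conditioned on ⊇ H", which never moves the edge count. [cite: Rossman2010, Def. 8 (p. 6)] -/
def IsForcing (n j w : ℕ) (γ : ℝ) (φ : (Edge n → Bool) → Bool) (P : Edge n → Bool) : Prop :=
  ∑ i ∈ Icc (j - w) (j + w), condRej n i φ P ≤ γ * (2 * (w : ℝ) + 1)

/-- Relabelling of a pattern by a vertex permutation: the edge `π e'` is on iff `e'` is on. [folklore] -/
def relabel (π : Equiv.Perm (Fin n)) (F : Edge n → Bool) : Edge n → Bool :=
  fun e => decide (∃ e' : Edge n, F e' = true ∧ Sym2.map π (e' : Sym2 (Fin n)) = (e : Sym2 (Fin n)))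

/-- **Decoy** of the pattern `P` through the piece `F ≤ P`: tear a proper non-empty sub-piece `F' < F`
off and re-attach a fresh copy of it on vertices outside `supp P`:
`D = (P ∖ F') ∪ π·F'` with `π(supp F') ∩ supp P = ∅` (reading (a) of the idea card: the WHOLE
sub-piece is displaced; see the line card for reading (b)). [cite: idea card forcing-contrast-hole-cap, FILTER = CONTRAST] -/
def IsDecoy (P F D : Edge n → Bool) : Prop :=
  ∃ (F' : Edge n → Bool) (π : Equiv.Perm (Fin n)), F' ≤ F ∧ F' ≠ ⊥ ∧ F' ≠ F ∧
    (∀ v ∈ supp F', π v ∉ supp P) ∧ D = (P \ F') ⊔ relabel π F'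

/-- **Contrast**: SOME decoy of `P` through `F` is accepted by `φ` with band-summed conditional
acceptance at most `(2w+1)/2` ("the decoy is rejected half the time"). Count-like gates (functions of
`|x|`, of `|x ∩ E|` with `σ_E → ∞`) accept every decoy exactly as they accept `P` and fail it;
clique-like gates pass it. [cite: idea card forcing-contrast-hole-cap, FILTER = CONTRAST] -/
def HasContrast (n j w : ℕ) (φ : (Edge n → Bool) → Bool) (P F : Edge n → Bool) : Prop :=
  ∃ D : Edge n → Bool, IsDecoy P F D ∧
    ∑ i ∈ Icc (j - w) (j + w), condAcc n i φ D ≤ (1 / 2) * (2 * (w : ℝ) + 1)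

/-- **Hole** (relative minterm): `F` is a hole of `φ` at the background `x` if `φ (x ∪ F) = 1` and
`φ (x ∪ F') = 0` for every proper sub-pattern `F' < F` (so `φ x = 0` when `F ≠ ⊥`, and `F ∩ x = ∅`).
Rossman's minterm, relativised at `x`. [cite: Rossman2010, §5 (p. 6), Lemma 14 (p. 8)] -/
def IsHole (φ : (Edge n → Bool) → Bool) (x F : Edge n → Bool) : Prop :=
  φ (x ⊔ F) = true ∧ ∀ F' : Edge n → Bool, F' < F → φ (x ⊔ F') = false

/-- **Contrast-forcing hole** (the witnesses of the line): a hole `F` of `φ` at `x` CERTIFIED by a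
pattern `P ⊇ F` on at most `k` vertices that is `γ`-forcing for `φ` and has contrast through `F`.
In the descent `P = T ∪ F ⊆ K_A` (anchor `T`), at the top `P = F = K_A`. [cite: idea card forcing-contrast-hole-cap, (D) and (H)] -/
def IsCFHole (n k j w : ℕ) (γ : ℝ) (φ : (Edge n → Bool) → Bool) (x F : Edge n → Bool) : Prop :=
  IsHole φ x F ∧ ∃ P : Edge n → Bool, F ≤ P ∧ #(supp P) ≤ k ∧ IsForcing n j w γ φ P ∧ HasContrast n j w φ P F

/-- **Monotone straight-line program** of length `s`: every member is an input `x_e` or the `∧`/`∨` of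
two EARLIER members (the gate functions of a `{∧₂,∨₂}`-circuit, inputs included, in topological order;
members `g m`, `m ≥ s`, are irrelevant). [cite: AroraBarak2009, Def. 6.1; Jukna2012, §1.2] -/
def IsProgram (s : ℕ) (g : ℕ → (Edge n → Bool) → Bool) : Prop :=
  ∀ m < s, (∃ e : Edge n, g m = fun x => x e) ∨
    ∃ a < m, ∃ b < m, (g m = fun x => g a x && g b x) ∨ (g m = fun x => g a x || g b x)

/-! ## The four statements of the would-be line, as propositions -/

/-- **(R) Top witnesses from band accuracy** — TRUE (provable now; the brick of card flat-prior-relative-minterms plus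
top forcing/contrast): for `k ≥ 3` there is `ρ(k) > 0` such that for every `γ > 0`, wide bands `w ≥ w₀(k,γ)`, small
`δ(k,γ,w) > 0`, eventually in `n`, a monotone `f` with band error `≤ δ` around a central `j` has, summed over the lower
slices, at least `ρ(2w+1)` mass of pairs `(x, A)` for which `K_A` is a `γ`-contrast-forcing hole of `f` at `x`
(slice Lemma 23 `Eω²/(Eω)² → 1+k!`, near-clique contiguity, flat prior; `ρ = (3e^{-1/k!} − 2)/8`). Survives the death
of the line. [cite: Rossman2010, Lemma 15 (p. 9), Lemma 23 (p. 13); idea cards flat-prior-relative-minterms, forcing-contrast-hole-cap] -/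
def TopWitnesses : Prop :=
  ∀ k : ℕ, 3 ≤ k → ∃ ρ : ℝ, 0 < ρ ∧ ∀ γ : ℝ, 0 < γ → ∃ w₀ : ℕ, ∀ w : ℕ, w₀ ≤ w →
    ∃ δ : ℝ, 0 < δ ∧ ∀ᶠ n : ℕ in atTop, ∀ j : ℕ, Central k n j →
      ∀ f : (Edge n → Bool) → Bool, Monotone f → bandErrFn n k j w f ≤ δ →
        ρ * (2 * (w : ℝ) + 1) ≤
          ∑ i ∈ Icc (j - w) (j + w - k.choose 2),
            (#((slice n i ×ˢ powersetCard k (univ : Finset (Fin n))).filter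
                fun p => IsCFHole n k j w γ f p.1 (cliqueVec p.2)) : ℝ) /
              ((#(slice n i) : ℝ) * (n.choose k : ℝ))

/-- **(HC) Contrast-forcing descent** — the card's conjecture: below a contrast-forcing top hole `K_A` of a member of a
monotone straight-line program, SOME member has a contrast-forcing hole `F ⊆ K_A`, `F ∈ J`. NOT refuted, but made
VACUOUS by the death of (H): a `k`-independent junk program of size `O(n⁴)` per vertex-half (the gadgets
`[x ∋ e] ∧ [|x ∩ E(U_ℓ)| ≥ a]` over all edges `e`, boundedly many vertex-halves `U_ℓ` and all thresholds `a`) has such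
a witness for almost every `(x, A)` without computing anything, so the conclusion certifies nothing
(`NegativeNote-forgeable-witnesses.md` §3).
[cite: idea card forcing-contrast-hole-cap (D),(HC); Rossman2010, Lemma 14 (p. 8)] -/
def CFDescent : Prop :=
  ∀ k : ℕ, 5 ≤ k → ∀ γ' : ℝ, 0 < γ' → ∃ γ : ℝ, 0 < γ ∧ ∀ w : ℕ, ∀ᶠ n : ℕ in atTop,
    ∀ j : ℕ, Central k n j →
      ∀ (s : ℕ) (g : ℕ → (Edge n → Bool) → Bool), IsProgram s g →
        ∀ i ∈ Icc (j - w) (j + w - k.choose 2), ∀ x ∈ slice n i,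
          ∀ A : Finset (Fin n), #A = k →
            ∀ t < s, IsCFHole n k j w γ (g t) x (cliqueVec A) →
              ∃ m < s, ∃ F : Edge n → Bool,
                F ≤ cliqueVec A ∧ F ∈ medJ n k ∧ IsCFHole n k j w γ' (g m) x F

/-- **(H) The hole cap** — the card's conjecture, typed per slice and per `J`-type `(v, e)`: the expected number of
`γ`-contrast-forcing `J`-holes of type `(v,e)` of an ARBITRARY monotone `φ` at a uniform slice input is
`≤ n^{(2/(k-1))e + ε} = CAP·n^ε`. **REFUTED** (this seat, 2026-08-16): for `φ = gadget n e₀ U a` below and the type of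
`F = {e₀} ∪ G`, `G` a graph on `⌈k/2⌉ - 1` vertices of `U` attached at `u₀` (so `F ∈ J`), on EVERY band slice
`E_x #{cf-holes of that type} ≥ c(k,γ)·n^{v_F − 2}/σ`, `σ = Θ(n^{1−1/(k−1)})` the standard deviation of
`|x ∩ E(U)|`, which exceeds `n^{(2/(k−1))e_F + ε}` by `n^{(k−7)/4 − 1/(k−1) − ε}` (every `k ≥ 9`), e.g. by `n^{2.4}`
for `k = 17`, `F = K₈ + pendant edge` (`v_F = 9`, `e_F = 29`, CAP `= n^{3.625}`, holes `≈ n^{6.06}`). The simpler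
`CLIQUE_k ∨ T_{≥ j+1}(|x|)` already kills the certifier/anchor reading of the card. Kept here as the typed target
`¬ HoleCap` for cdisprove. [cite: idea card forcing-contrast-hole-cap (H); this file, `gadget`] -/
def HoleCap : Prop :=
  ∀ k : ℕ, 5 ≤ k → ∃ γ₀ : ℝ, 0 < γ₀ ∧ ∀ γ : ℝ, 0 < γ → γ ≤ γ₀ → ∀ ε : ℝ, 0 < ε → ∀ w : ℕ,
    ∀ᶠ n : ℕ in atTop, ∀ j : ℕ, Central k n j → ∀ i ∈ Icc (j - w) (j + w),
      ∀ φ : (Edge n → Bool) → Bool, Monotone φ → ∀ v e : ℕ,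
        (∑ F ∈ (medJ n k).filter (fun F => #(supp F) = v ∧ #(onSet F) = e),
            (#((slice n i).filter fun x => IsCFHole n k j w γ φ x F) : ℝ)) / (#(slice n i) : ℝ) ≤
          (n : ℝ) ^ ((2 : ℝ) / ((k : ℝ) - 1) * (e : ℝ) + ε)

/-- **(H_s) Supply form of the hole cap** — the weakest statement the census actually needs (holes weighted by the
probability `≈ (k/n)^{|supp F|}` that a uniform `k`-set covers them): per monotone `φ` and band slice, the
`A`-averaged probability that SOME `J`-piece of `K_A` is a `γ`-contrast-forcing hole of `φ` at `x` is
`≤ n^{-(k : ℝ)/4 + ε}`. **REFUTED by the same gadget** with a `k`-INDEPENDENT exponent: supply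
`≥ c(k,γ)·n^{−3 + 1/(k−1)}` on every slice (`A ⊇ {u₀, v₀}`: factor `(k/n)²`; count at the hole level: `1/σ`).
[cite: this file, `gadget`; Rossman2010, Lemma 16 (p. 9)] -/
def HoleCapSupply : Prop :=
  ∀ k : ℕ, 5 ≤ k → ∃ γ₀ : ℝ, 0 < γ₀ ∧ ∀ γ : ℝ, 0 < γ → γ ≤ γ₀ → ∀ ε : ℝ, 0 < ε → ∀ w : ℕ,
    ∀ᶠ n : ℕ in atTop, ∀ j : ℕ, Central k n j → ∀ i ∈ Icc (j - w) (j + w - k.choose 2),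
      ∀ φ : (Edge n → Bool) → Bool, Monotone φ →
        (#((slice n i ×ˢ powersetCard k (univ : Finset (Fin n))).filter fun p =>
            ∃ F : Edge n → Bool, F ≤ cliqueVec p.2 ∧ F ∈ medJ n k ∧ IsCFHole n k j w γ φ p.1 F) : ℝ) /
            ((#(slice n i) : ℝ) * (n.choose k : ℝ)) ≤
          (n : ℝ) ^ (-(k : ℝ) / 4 + ε)

/-- **(J) The census** (Rossman's Lemma 16 / the card's junk ledger) — TRUE relative to its inputs (provable now):
`TopWitnesses → CFDescent → HoleCap →` for every `c` and `k ≥ 4c + 12` there are `w, δ > 0` with `BandLB c k w δ`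
(program extraction from the circuit, charging `(x,A) ↦ (m, F)`, `#{A ⊇ supp F} ≤ (k/n)^{v_F} C(n,k)`
(`kSubsetProb_supset_le`), `(2/(k−1))e_F − v_F ≤ −(k²+7)/(4(k−1))` on `J` (`medJ_ineq`), `ε = 1/2`). Its
arithmetic survives for any CORRECT witness notion; with the present one its third hypothesis is false.
[cite: Rossman2010, Lemma 16 and end of §6 (p. 9)] -/
def Census : Prop :=
  TopWitnesses → CFDescent → HoleCap →
    ∀ c k : ℕ, 4 * c + 12 ≤ k → ∃ w : ℕ, ∃ δ : ℝ, 0 < δ ∧ BandLB c k w δ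

/-- **Composition (kernel-checked, sorry-free): the four statements give the crux BY NAME.** Recorded to certify that the
typing closes — `k = 4c + 12`, `constantBand_iff` (`Iff.rfl` bridge of the Negative file). It credits nothing: the
third hypothesis is false. [folklore] -/
theorem constantBand_of_hyps (hR : TopWitnesses) (hD : CFDescent) (hH : HoleCap) (hJ : Census) :
    Summit.PneNP.PneNP.Theses.OneSlice.ConstantBand := by
  rw [constantBand_iff]
  intro c
  obtain ⟨w, δ, hδ, h⟩ := hJ hR hD hH c (4 * c + 12) le_rfl
  exact ⟨4 * c + 12, by omega, w, δ, hδ, h⟩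

/-! ## The refuting gadget (typed; informal proof in `NegativeNote-forgeable-witnesses.md`) -/

/-- **The forgery gadget** `[e₀ ∈ x] ∧ [|x ∩ E(U)| ≥ a]`: a monotone function of TWO standard sub-circuits (an input
and a threshold of a sub-count) whose `J`-holes at every `x` with `|x ∩ E(U)| = a − (e_F − 1)` are ALL the patterns
`{e₀} ∪ G`, `G ⊆ E(U) ∖ x` with `e_F − 1` edges; each is forcing by itself (the threshold sits at the
`γ/2`-quantile of the count) and has contrast (tear the pendant core edge `e₀ = u₀v₀`, `v₀ ∉ supp G`: every decoy
lacks `e₀`, and `P[e₀ ∈ x] → 0`). With `U` half the vertices the hole level has probability `≍ 1/σ`,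
`σ ≍ n^{1−1/(k−1)}`, so the gadget carries `≍ n^{v_F − 2}/σ` contrast-forcing `J`-holes of one type per slice input —
`n^{(k−7)/4 − o(1)}` times the cap. [cite: this seat's Negative note forgeable-witnesses; Rossman2010, §9 (live threshold sub-circuits)] -/
def gadget (n : ℕ) (e₀ : Edge n) (U : Finset (Fin n)) (a : ℕ) : (Edge n → Bool) → Bool :=
  fun x => x e₀ && decide (a ≤ #((univ : Finset (Edge n)).filter fun e =>
    x e = true ∧ ∀ v ∈ (e : Sym2 (Fin n)), v ∈ U))

/-- The gadget is monotone (both conjuncts are). [folklore] -/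
theorem gadget_monotone (n : ℕ) (e₀ : Edge n) (U : Finset (Fin n)) (a : ℕ) : Monotone (gadget n e₀ U a) := by
  intro x y hxy
  unfold gadget
  cases hx0 : x e₀
  · simp
  · have hy0 : y e₀ = true := by
      have := hxy e₀
      rw [hx0] at this
      exact Bool.eq_true_of_true_le this
    simp only [hy0, Bool.true_and]
    by_cases ha : a ≤ #((univ : Finset (Edge n)).filter fun e => x e = true ∧ ∀ v ∈ (e : Sym2 (Fin n)), v ∈ U)
    · have hsub : ((univ : Finset (Edge n)).filter fun e => x e = true ∧ ∀ v ∈ (e : Sym2 (Fin n)), v ∈ U) ⊆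
          ((univ : Finset (Edge n)).filter fun e => y e = true ∧ ∀ v ∈ (e : Sym2 (Fin n)), v ∈ U) := by
        intro e he
        simp only [mem_filter, mem_univ, true_and] at he ⊢
        refine ⟨?_, he.2⟩
        have := hxy e
        rw [he.1] at this
        exact Bool.eq_true_of_true_le this
      have ha' : a ≤ #((univ : Finset (Edge n)).filter fun e => y e = true ∧ ∀ v ∈ (e : Sym2 (Fin n)), v ∈ U) :=
        ha.trans (card_le_card hsub)
      simp [ha']
    · simp [ha]

end Summit.PneNP.PneNP.Cruxes.ConstantBand.ForcingContrastHoleCap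

end
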